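import Mathlib
import Summits.ValiantsHypothesis.ValiantsHypothesis.Theorems.NewtonTauWeak.Negative.Zonogon
import Summits.ValiantsHypothesis.ValiantsHypothesis.Theorems.NewtonUnitEquationsNewtonTauWeakSeparatedRank
import Summits.ValiantsHypothesis.ValiantsHypothesis.Theorems.NewtonUnitEquationsNewtonTauWeakVdpDefs
import Summits.ValiantsHypothesis.ValiantsHypothesis.Theorems.NewtonUnitEquationsNewtonTauWeakStubVertexCharts
import Summits.ValiantsHypothesis.ValiantsHypothesis.Theorems.NewtonUnitEquationsNewtonTauWeakStubChartPairCount
import Summits.ValiantsHypothesis.ValiantsHypothesis.Theorems.NewtonUnitEquationsNewtonTauWeakStubProductVertices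
import Summits.ValiantsHypothesis.ValiantsHypothesis.Theorems.NewtonUnitEquationsNewtonTauWeakHexagonDelta
import Summits.ValiantsHypothesis.ValiantsHypothesis.Theorems.NewtonUnitEquationsNewtonTauWeakHexagonSeparated
import Summits.ValiantsHypothesis.ValiantsHypothesis.Theorems.NewtonUnitEquationsNewtonTauWeakHexagonVertexTools
import Summits.ValiantsHypothesis.ValiantsHypothesis.Theorems.NewtonUnitEquationsNewtonTauWeakHexagonPlanar
import Summits.ValiantsHypothesis.ValiantsHypothesis.Theorems.NewtonUnitEquationsNewtonTauWeakHexagonTrichotomy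
import Summits.ValiantsHypothesis.ValiantsHypothesis.Theorems.NewtonUnitEquationsNewtonTauWeakHexagonDichotomy
import Summits.ValiantsHypothesis.ValiantsHypothesis.Theorems.NewtonUnitEquationsNewtonTauWeakHexagonChartCountRoots
import Summits.ValiantsHypothesis.ValiantsHypothesis.Theorems.NewtonUnitEquationsNewtonTauWeakHexagonUnion
import Summits.ValiantsHypothesis.ValiantsHypothesis.Theorems.NewtonUnitEquationsNewtonTauWeakHexagonMinorStructure

/-!
# `NewtonUnitEquationsNewtonTauWeakHexagonAllK` — H_K: sums of `K` hexagon products, every `K`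

Rung toward `stub_binomialNewtonTauCommon` (T2 = KPTT Conj. 1 at `t = 2`; crux `NewtonTauWeak`,
stmt-ValiantsHypothesis-5904), line `binomial-normal-form`, lead c3 (card
`Cruxes/NewtonTauWeak/Lines/binomial-normal-form-delta-global.md` §2).

`hex_vert_sum_hexagon_le_allK`: for EVERY `K`, x-only `X_l`, y-only `Y_l`, diagonal `D_l ∈ ℂ[X,Y]` (supports on
the rays `(1,0)`, `(0,1)`, `(1,1)`; ANY degrees),
`vert(Σ_{l<K} X_l·Y_l·D_l) ≤ 4 + 4K(K+1)(8 + 8·K!·2^{K·K})` — T2 at every FIXED `K` on three lines, degree-free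
(digit frames included).  Proof — the HOMOGENEOUS Wronskian route (no Cramer, no chart pairs, no degenerate
cases): with the Euler derivation `Δ = X∂_X - Y∂_Y` (abstractly: coefficient law; `hex_exists_delta`), choose an
injective column selection `e : Fin s → Fin K` with nonzero generalised Wronskian `det[Δ^a g_{e b}]` and `s`
maximal (`Nat.findGreatest`); every `(s+1) × (s+1)` determinant with an appended column `g_l` vanishes (repeated
column, or maximality), and Laplace expansion along that column (`Matrix.det_succ_column`) gives
`Σ_{i≤s} (-1)^i m_i Δ^i g_l = 0` with minors `m_i` independent of `l`, `m_s ≠ 0`; summing over `l`,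
`Σ_i (-1)^i m_i Δ^i f = 0` (`HexagonAllK.exists_homogeneous_equation`).  The minors are (diagonal) × (separated
of rank `≤ s!·2^{Σ rows} ≤ K!·2^{K·K}`) (`hex_structure_minor`), so each has `≤ 8 + 8·K!·2^{K·K}` Newton vertices
(`hex_vert_diag_mul_le`); at a generic weight an off-diagonal top `v` of `f` has `v₀ - v₁` among the `≤ K`
roots of `P_z(T) = Σ_i (-1)^i coeff_z(m_i) T^i`, `z` the simultaneous top of the indicator of `∪ supp m_i`
(`hex_key_dichotomy`), and the root-form chart count `hex_chart_count_roots` with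
`#chartTops(U) ≤ Σ_i V(m_i)` (`hex_ncard_chartTops_iUnion_le`) bounds both charts (`stub_vertexCharts`).
[folklore: Wronskian method with the direction-killing derivation]
-/

set_option linter.dupNamespace false

noncomputable section

namespace Summit.ValiantsHypothesis.ValiantsHypothesis.Theorems.NewtonUnitEquationsNewtonTauWeak

open scoped BigOperators
open MvPolynomial
open Literature.Computability.AlgebraicComplexity (newtonVertexCount)
open Summit.ValiantsHypothesis.ValiantsHypothesis.Theorems.NewtonTauWeakVdp
open Summit.ValiantsHypothesis.ValiantsHypothesis.Theorems.NewtonTauWeak.Negative (vert)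

namespace HexagonAllK

/-- Iterates of an additive `Δ` are additive over finite sums. [folklore] -/
theorem delta_iterate_sum (Δ : MvPolynomial (Fin 2) ℂ → MvPolynomial (Fin 2) ℂ)
    (hΔ : ∀ p e, coeff e (Δ p) = (((e 0 : ℕ) : ℂ) - ((e 1 : ℕ) : ℂ)) * coeff e p)
    (k : ℕ) {ι : Type*} (s : Finset ι) (f : ι → MvPolynomial (Fin 2) ℂ) :
    (Δ^[k]) (∑ i ∈ s, f i) = ∑ i ∈ s, (Δ^[k]) (f i) := by
  induction k with
  | zero => simp
  | succ k ih => rw [Function.iterate_succ_apply', ih, HexagonTrichotomy.delta_sum' Δ hΔ]; simp [Function.iterate_succ_apply']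

/-- **The homogeneous Wronskian equation.** For any finite family `g` there is an injective column selection
`e : Fin s ↪ Fin K` with nonzero generalised Wronskian and maximal `s`; Laplace expansion of the
`(s+1) × (s+1)` determinants with an appended column (zero: repeated column, or maximality) along that column
gives `Σ_{i ≤ s} (-1)^i · m_i · Δ^i g_l = 0` for EVERY `l`, with minors `m_i` independent of `l` and `m_s ≠ 0`;
summing over `l` gives the equation for `f = Σ_l g_l`. [folklore] -/
theorem exists_homogeneous_equation (Δ : MvPolynomial (Fin 2) ℂ → MvPolynomial (Fin 2) ℂ)
    (hΔ : ∀ p e, coeff e (Δ p) = (((e 0 : ℕ) : ℂ) - ((e 1 : ℕ) : ℂ)) * coeff e p)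
    {K : ℕ} (g : Fin K → MvPolynomial (Fin 2) ℂ) :
    ∃ (s : ℕ) (e : Fin s → Fin K), s ≤ K ∧ Function.Injective e ∧
      (Matrix.of fun a b : Fin s => (Δ^[(a : ℕ)]) (g (e b))).det ≠ 0 ∧
      ∑ i : Fin (s + 1), (-1 : MvPolynomial (Fin 2) ℂ) ^ (i : ℕ) *
        ((Matrix.of fun a b : Fin s => (Δ^[((Fin.succAbove i a : Fin (s + 1)) : ℕ)]) (g (e b))).det *
          (Δ^[(i : ℕ)]) (∑ l, g l)) = 0 := by
  classical
  -- maximal size of an injective column selection with nonzero Wronskian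
  set Good : ℕ → Prop := fun s => ∃ e : Fin s → Fin K, Function.Injective e ∧
    (Matrix.of fun a b : Fin s => (Δ^[(a : ℕ)]) (g (e b))).det ≠ 0 with hGood
  have hGood0 : Good 0 := ⟨Fin.elim0, fun a => Fin.elim0 a, by rw [Matrix.det_fin_zero]; exact one_ne_zero⟩
  set s := Nat.findGreatest Good K with hs
  have hsK : s ≤ K := Nat.findGreatest_le K
  obtain ⟨e, he, hdet⟩ : Good s := Nat.findGreatest_spec (Nat.zero_le K) hGood0
  refine ⟨s, e, hsK, he, hdet, ?_⟩
  -- the appended matrices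
  set col : Fin K → Fin (s + 1) → MvPolynomial (Fin 2) ℂ := fun l => Fin.snoc (fun b => g (e b)) (g l)
    with hcol
  set A : Fin K → Matrix (Fin (s + 1)) (Fin (s + 1)) (MvPolynomial (Fin 2) ℂ) := fun l =>
    Matrix.of fun a b => (Δ^[(a : ℕ)]) (col l b) with hA
  -- their determinants vanish
  have hdetA : ∀ l, (A l).det = 0 := by
    intro l
    by_cases hl : ∃ b, e b = l
    · obtain ⟨b, hb⟩ := hl
      refine Matrix.det_zero_of_column_eq (i := Fin.castSucc b) (j := Fin.last s) (Fin.castSucc_lt_last b).ne ?_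
      intro a
      simp [hA, hcol, Fin.snoc_castSucc, Fin.snoc_last, hb]
    · push Not at hl
      -- the extended selection is injective, so maximality applies
      set e' : Fin (s + 1) → Fin K := Fin.snoc e l with he'
      have he'inj : Function.Injective e' := by
        intro a b hab
        induction a using Fin.lastCases with
        | last =>
          induction b using Fin.lastCases with
          | last => rfl
          | cast b =>
            exfalso
            simp only [he', Fin.snoc_last, Fin.snoc_castSucc] at hab
            exact hl b hab.symm
        | cast a =>
          induction b using Fin.lastCases with
          | last =>
            exfalso
            simp only [he', Fin.snoc_last, Fin.snoc_castSucc] at hab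
            exact hl a hab
          | cast b =>
            simp only [he', Fin.snoc_castSucc] at hab
            rw [he hab]
      have hsK' : s + 1 ≤ K := by
        have h := Fintype.card_le_of_injective e' he'inj
        simpa using h
      have hnot : ¬ Good (s + 1) := Nat.findGreatest_is_greatest (Nat.lt_succ_self s) hsK'
      by_contra hne
      apply hnot
      refine ⟨e', he'inj, ?_⟩
      have hAe : (Matrix.of fun a b : Fin (s + 1) => (Δ^[(a : ℕ)]) (g (e' b))) = A l := by
        ext a b
        simp only [hA, hcol, he', Matrix.of_apply]
        induction b using Fin.lastCases with
        | last => simp [Fin.snoc_last]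
        | cast b => simp [Fin.snoc_castSucc]
      rw [hAe]
      exact hne
  -- Laplace expansion along the last column
  have hlap : ∀ l, ∑ i : Fin (s + 1), (-1 : MvPolynomial (Fin 2) ℂ) ^ (i : ℕ) *
      ((Matrix.of fun a b : Fin s => (Δ^[((Fin.succAbove i a : Fin (s + 1)) : ℕ)]) (g (e b))).det *
        (Δ^[(i : ℕ)]) (g l)) = 0 := by
    intro l
    have h := Matrix.det_succ_column (A l) (Fin.last s)
    rw [hdetA l] at h
    -- identify the terms
    have hsub : ∀ i : Fin (s + 1), (A l).submatrix i.succAbove (Fin.last s).succAbove =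
        Matrix.of fun a b : Fin s => (Δ^[((Fin.succAbove i a : Fin (s + 1)) : ℕ)]) (g (e b)) := by
      intro i
      ext a b
      simp [hA, hcol, Matrix.submatrix_apply, Fin.succAbove_last, Fin.snoc_castSucc]
    have hlast : ∀ i : Fin (s + 1), A l i (Fin.last s) = (Δ^[(i : ℕ)]) (g l) := by
      intro i
      simp [hA, hcol, Fin.snoc_last]
    -- `(-1)^(i + s) = (-1)^s * (-1)^i`; cancel the unit `(-1)^s`
    have h' : (-1 : MvPolynomial (Fin 2) ℂ) ^ (s : ℕ) * ∑ i : Fin (s + 1), (-1 : MvPolynomial (Fin 2) ℂ) ^ (i : ℕ) *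
        ((Matrix.of fun a b : Fin s => (Δ^[((Fin.succAbove i a : Fin (s + 1)) : ℕ)]) (g (e b))).det *
          (Δ^[(i : ℕ)]) (g l)) = 0 := by
      rw [Finset.mul_sum]
      calc ∑ i : Fin (s + 1), (-1 : MvPolynomial (Fin 2) ℂ) ^ (s : ℕ) * ((-1 : MvPolynomial (Fin 2) ℂ) ^ (i : ℕ) *
            ((Matrix.of fun a b : Fin s => (Δ^[((Fin.succAbove i a : Fin (s + 1)) : ℕ)]) (g (e b))).det *
              (Δ^[(i : ℕ)]) (g l)))
          = ∑ i : Fin (s + 1), (-1) ^ (i + Fin.last s : ℕ) * A l i (Fin.last s) *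
              ((A l).submatrix i.succAbove (Fin.last s).succAbove).det := by
            refine Finset.sum_congr rfl fun i _ => ?_
            rw [hsub i, hlast i, Fin.val_last, pow_add]
            ring
        _ = 0 := h.symm
    rcases mul_eq_zero.mp h' with h1 | h1
    · exact absurd h1 (pow_ne_zero _ (neg_ne_zero.mpr one_ne_zero))
    · exact h1
  -- sum over `l`
  have hsum : ∑ l, ∑ i : Fin (s + 1), (-1 : MvPolynomial (Fin 2) ℂ) ^ (i : ℕ) *
      ((Matrix.of fun a b : Fin s => (Δ^[((Fin.succAbove i a : Fin (s + 1)) : ℕ)]) (g (e b))).det *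
        (Δ^[(i : ℕ)]) (g l)) = 0 := Finset.sum_eq_zero fun l _ => hlap l
  rw [Finset.sum_comm] at hsum
  rw [← hsum]
  refine Finset.sum_congr rfl fun i _ => ?_
  rw [delta_iterate_sum Δ hΔ, Finset.mul_sum, Finset.mul_sum]

end HexagonAllK

namespace HexagonAllK

/-- A product of diagonal polynomials is diagonal. [folklore] -/
theorem diag_prod {ι : Type*} (t : Finset ι) (D : ι → MvPolynomial (Fin 2) ℂ)
    (hD : ∀ b ∈ t, ∀ e ∈ (D b).support, e 0 = e 1) : ∀ e ∈ (∏ b ∈ t, D b).support, e 0 = e 1 := by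
  classical
  refine Finset.prod_induction D (fun p : MvPolynomial (Fin 2) ℂ => ∀ e ∈ p.support, e 0 = e 1)
    (fun p q hp hq => hex_diag_mul p q hp hq) ?_ hD
  intro e he
  rw [← C_1, ← monomial_zero'] at he
  rw [Finset.mem_singleton.mp (support_monomial_subset he)]
  rfl

/-- The polynomial `P_z(T) = Σ_i (-1)^i coeff_z(N_i) T^i`: degree, vanishing and evaluation. [folklore] -/
theorem rootPoly_props {n : ℕ} (a : Fin (n + 1) → ℂ) :
    (∑ i : Fin (n + 1), Polynomial.C (a i) * Polynomial.X ^ (i : ℕ)).natDegree ≤ n ∧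
    (∀ i, a i ≠ 0 → (∑ i : Fin (n + 1), Polynomial.C (a i) * Polynomial.X ^ (i : ℕ)) ≠ 0) ∧
    (∀ x : ℂ, (∑ i : Fin (n + 1), Polynomial.C (a i) * Polynomial.X ^ (i : ℕ)).eval x =
      ∑ i : Fin (n + 1), a i * x ^ (i : ℕ)) := by
  classical
  have hcoeff : ∀ i : Fin (n + 1),
      (∑ j : Fin (n + 1), Polynomial.C (a j) * Polynomial.X ^ (j : ℕ)).coeff (i : ℕ) = a i := by
    intro i
    rw [Polynomial.finsetSum_coeff, Finset.sum_eq_single i]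
    · rw [Polynomial.coeff_C_mul_X_pow, if_pos rfl]
    · intro j _ hji
      rw [Polynomial.coeff_C_mul_X_pow, if_neg]
      exact fun h => hji (Fin.ext h.symm)
    · intro h; exact absurd (Finset.mem_univ i) h
  refine ⟨?_, ?_, ?_⟩
  · refine Polynomial.natDegree_sum_le_of_forall_le _ _ fun i _ => ?_
    exact (Polynomial.natDegree_C_mul_X_pow_le (a i) i).trans (Nat.lt_succ_iff.mp i.isLt)
  · intro i hi h
    apply hi
    rw [← hcoeff i, h, Polynomial.coeff_zero]
  · intro x
    rw [Polynomial.eval_finsetSum]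
    refine Finset.sum_congr rfl fun i _ => ?_
    rw [Polynomial.eval_mul, Polynomial.eval_C, Polynomial.eval_pow, Polynomial.eval_X]

end HexagonAllK

open HexagonAllK

/-- **H_K: sums of `K` hexagon products have boundedly many Newton vertices, for every `K`.** For x-only `X_l`,
y-only `Y_l`, diagonal `D_l ∈ ℂ[X,Y]` (any degrees), `vert(Σ_{l<K} X_l·Y_l·D_l) ≤ 4 + 4K(K+1)(8 + 8·K!·2^{K·K})`.
Proof: homogeneous Wronskian equation (`HexagonAllK.exists_homogeneous_equation`), minors = (diagonal) ×
(separated of rank `≤ K!·2^{K·K}`) (`hex_structure_minor`), dichotomy (`hex_key_dichotomy`) and the root-form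
chart count (`hex_chart_count_roots`). [folklore] -/
theorem hex_vert_sum_hexagon_le_allK (K : ℕ) (X Y D : Fin K → MvPolynomial (Fin 2) ℂ)
    (hX : ∀ l, ∀ e ∈ (X l).support, e 1 = 0) (hY : ∀ l, ∀ e ∈ (Y l).support, e 0 = 0)
    (hD : ∀ l, ∀ e ∈ (D l).support, e 0 = e 1) :
    vert (∑ l, X l * Y l * D l) ≤ 4 + 4 * K * (K + 1) * (8 + 8 * (Nat.factorial K * 2 ^ (K * K))) := by
  classical
  obtain ⟨Δ, hΔ⟩ := hex_exists_delta
  have hL := hex_delta_mul Δ hΔ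
  change newtonVertexCount (∑ l, X l * Y l * D l) ≤ _
  set g : Fin K → MvPolynomial (Fin 2) ℂ := fun l => X l * Y l * D l with hg
  have hFg : (∑ l, X l * Y l * D l) = ∑ l, g l := rfl
  rw [hFg]
  set F := ∑ l, g l with hF
  obtain ⟨s, e, hsK, he, hdet, hid⟩ := exists_homogeneous_equation Δ hΔ g
  set N : Fin (s + 1) → MvPolynomial (Fin 2) ℂ := fun i =>
    (Matrix.of fun a b : Fin s => (Δ^[((Fin.succAbove i a : Fin (s + 1)) : ℕ)]) (g (e b))).det with hN
  have hid' : ∑ i : Fin (s + 1), (-1 : MvPolynomial (Fin 2) ℂ) ^ (i : ℕ) * (N i * (Δ^[(i : ℕ)]) F) = 0 := hid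
  -- the common bound on the vertex counts of the minors
  set B : ℕ := Nat.factorial K * 2 ^ (K * K) with hB
  have hVN : ∀ i, newtonVertexCount (N i) ≤ 8 + 8 * B := by
    intro i
    obtain ⟨m, ⟨R, hR, P, Q, hP, hQ, hm⟩, hEq⟩ := hex_structure_minor Δ hΔ hL
      (fun b => X (e b)) (fun b => Y (e b)) (fun b => D (e b))
      (fun b => hX (e b)) (fun b => hY (e b)) (fun b => hD (e b))
      (fun a => ((Fin.succAbove i a : Fin (s + 1)) : ℕ))
    have hdiag : ∀ v ∈ (∏ b, D (e b)).support, v 0 = v 1 :=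
      diag_prod Finset.univ (fun b => D (e b)) fun b _ => hD (e b)
    have h := hex_vert_diag_mul_le (∏ b, D (e b)) m hdiag ⟨P, Q, hP, hQ, hm⟩
    have hNi : N i = (∏ b, D (e b)) * m := hEq
    rw [hNi]
    refine h.trans ?_
    have hR' : R ≤ B := by
      refine hR.trans ?_
      have h1 : Nat.factorial s ≤ Nat.factorial K := Nat.factorial_le hsK
      have h2 : 2 ^ (∑ a : Fin s, ((Fin.succAbove i a : Fin (s + 1)) : ℕ)) ≤ 2 ^ (K * K) := by
        apply Nat.pow_le_pow_right (by norm_num)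
        calc ∑ a : Fin s, ((Fin.succAbove i a : Fin (s + 1)) : ℕ) ≤ ∑ _a : Fin s, s :=
              Finset.sum_le_sum fun a _ => Nat.lt_succ_iff.mp (Fin.succAbove i a).isLt
          _ = s * s := by rw [Finset.sum_const, Finset.card_univ, Fintype.card_fin, smul_eq_mul]
          _ ≤ K * K := Nat.mul_le_mul hsK hsK
      exact Nat.mul_le_mul h1 h2
    omega
  -- the indicator of the union of the supports
  set S := (Finset.univ : Finset (Fin (s + 1))).biUnion fun i => (N i).support with hS
  set U : MvPolynomial (Fin 2) ℂ := ∑ v ∈ S, monomial v (1 : ℂ) with hU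
  have hUsupp : U.support = S := hex_support_sum_monomial_one S
  have hUiff : ∀ v, v ∈ U.support ↔ ∃ i, v ∈ (N i).support := by
    intro v
    rw [hUsupp, hS, Finset.mem_biUnion]
    simp
  have hNlast : N (Fin.last s) ≠ 0 := by
    have h : N (Fin.last s) = (Matrix.of fun a b : Fin s => (Δ^[(a : ℕ)]) (g (e b))).det := by
      simp only [hN]
      congr 1
      ext a b
      simp [Fin.succAbove_last]
    rw [h]; exact hdet
  have hU0 : U ≠ 0 := by
    intro h
    have hne : (N (Fin.last s)).support.Nonempty := by
      rw [Finset.nonempty_iff_ne_empty, Ne, support_eq_empty]; exact hNlast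
    obtain ⟨v, hv⟩ := hne
    have : v ∈ U.support := (hUiff v).mpr ⟨_, hv⟩
    rw [h, support_zero] at this
    exact absurd this (Finset.notMem_empty v)
  -- chart tops of `U`
  have hTU : ∀ σ : ℝ, {z : Fin 2 →₀ ℕ | ∃ t : ℝ, IsGeneric ![σ, t] ∧ IsTop ![σ, t] U z}.ncard ≤
      (K + 1) * (8 + 8 * B) := by
    intro σ
    refine (hex_ncard_chartTops_iUnion_le σ U N hUiff).trans ?_
    calc ∑ i, newtonVertexCount (N i) ≤ ∑ _i : Fin (s + 1), (8 + 8 * B) := Finset.sum_le_sum fun i _ => hVN i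
      _ = (s + 1) * (8 + 8 * B) := by rw [Finset.sum_const, Finset.card_univ, Fintype.card_fin, smul_eq_mul]
      _ ≤ (K + 1) * (8 + 8 * B) := Nat.mul_le_mul_right _ (by omega)
  -- the root polynomial and the dichotomy
  set Pz : (Fin 2 →₀ ℕ) → Polynomial ℂ := fun z =>
    ∑ i : Fin (s + 1), Polynomial.C ((-1 : ℂ) ^ (i : ℕ) * coeff z (N i)) * Polynomial.X ^ (i : ℕ) with hPz
  have hPz' : ∀ z ∈ U.support, Pz z ≠ 0 ∧ (Pz z).natDegree ≤ K := by
    intro z hz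
    obtain ⟨hdeg, hne, -⟩ := rootPoly_props (fun i : Fin (s + 1) => (-1 : ℂ) ^ (i : ℕ) * coeff z (N i))
    obtain ⟨i, hi⟩ := (hUiff z).mp hz
    refine ⟨hne i ?_, hdeg.trans hsK⟩
    exact mul_ne_zero (pow_ne_zero _ (neg_ne_zero.mpr one_ne_zero)) (mem_support_iff.mp hi)
  have hroot : ∀ σ : ℝ, ∀ t : ℝ, IsGeneric ![σ, t] → ∀ v z : Fin 2 →₀ ℕ, IsTop ![σ, t] F v → v 0 ≠ v 1 →
      IsTop ![σ, t] U z → (Pz z).IsRoot ((((v 0 : ℕ) : ℂ)) - ((v 1 : ℕ) : ℂ)) := by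
    intro σ t ht v z hv hvv hz
    obtain ⟨-, -, heval⟩ := rootPoly_props (fun i : Fin (s + 1) => (-1 : ℂ) ^ (i : ℕ) * coeff z (N i))
    rw [Polynomial.IsRoot.def, hPz, heval]
    have h := hex_key_dichotomy Δ hΔ N F U hid' hUiff ht hv hvv hz
    rw [← h]
  -- count
  have hchart : ∀ σ : ℝ, {v : Fin 2 →₀ ℕ | ∃ t : ℝ, IsGeneric ![σ, t] ∧ IsTop ![σ, t] F v}.ncard ≤
      2 + 2 * K * ((K + 1) * (8 + 8 * B)) := by
    intro σ
    refine (hex_chart_count_roots σ F U K Pz hPz' (hroot σ) hU0).trans ?_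
    have h := hTU σ
    have : 2 * K * {z : Fin 2 →₀ ℕ | ∃ t : ℝ, IsGeneric ![σ, t] ∧ IsTop ![σ, t] U z}.ncard ≤
        2 * K * ((K + 1) * (8 + 8 * B)) := Nat.mul_le_mul_left _ h
    omega
  have hv := stub_vertexCharts F
  have h1 := hchart 1
  have h2 := hchart (-1)
  have hKB : 2 * K * ((K + 1) * (8 + 8 * B)) = 2 * (K * (K + 1) * (8 + 8 * B)) := by ring
  rw [hKB] at h1 h2
  calc newtonVertexCount F ≤ _ := hv
    _ ≤ (2 + 2 * (K * (K + 1) * (8 + 8 * B))) + (2 + 2 * (K * (K + 1) * (8 + 8 * B))) := add_le_add h1 h2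
    _ = 4 + 4 * K * (K + 1) * (8 + 8 * B) := by ring

end Summit.ValiantsHypothesis.ValiantsHypothesis.Theorems.NewtonUnitEquationsNewtonTauWeak

end
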